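import Literature.NumberTheory.IwasawaTheory.Greenberg2016.SelmerGroupStructure
import Summits.BirchSwinnertonDyer.BirchSwinnertonDyer.Theorems.EisensteinPrimesBSDpOnCellCTelescopeK2RepDescent
import HarnessLib

/-!
# Crux 4 `BSDpOnCellC` (stmt-BirchSwinnertonDyer-19034), line «telescope», leaf K2-M♭ / N2, sub-leaf W4a (route G, item G1):
# the DICTIONARY between the K2 line's `Γ_K`-Selmer groups and Greenberg's `G_{K,Σ}`-Selmer groups `S_𝓛(K, 𝐃)` (helper; closes nothing)

Route `EisensteinPrimes`, crux `BSDpOnCellC`; ideator seat `bsd-idea-12` (gen 36), `--supports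
stmt-BirchSwinnertonDyer-19034 --as helper`. THEOREMS + three bookkeeping `def`s (a specification and two
linear equivalences); no instance, no named fact, no `sorry`. HONEST FRAMING: a dictionary; proves no crux,
no registered stub, no summit statement; BSD is proved for no curve here.

WHAT AND WHY. «Route G» (LEAD cruxlead-19034 g2, bsd-eis STATUS 2026-08-29T21:00:44Z; priced in
`Cruxes/BSDpOnCellC/W-PRICING-n2.md` rev 1.3 §W4-G) discharges the purity input W4 of leaf N2 through
Greenberg's structure theory [Gr16, Prop. 4.1.1], whose tree arena (`Greenberg2016.Specification`, `.selmer`,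
`SUR`, `CRK`, `prop411_selmer_isAlmostDivisible`, the case-(c) theorems) lives on
`ρ : ContinuousRep (GaloisGroupUnramifiedOutside K Σ) Λ 𝐃` with Selmer group `S_𝓛(K, 𝐃) = ker (H¹(K_Σ/K, 𝐃) →
∏_{v ∈ Σ} H¹(K_v, 𝐃)/L_v)`, whereas the K2 line's Selmer groups (`BigGaloisRep.selmerBig`, `XBig`) are
`TorsionControl.selmer (BigGaloisRep.localMap K) L₀ (ρ.restrict θ)`: classes of `H¹(Γ_K, 𝐃)` killed by
restriction to the decomposition group (`Sum.inl w ∈ L₀`) or the inertia group (`Sum.inr w ∈ L₀`) at the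
listed finite places. Item G1 of the memo is the identification of the two. This file proves it:

* §1 (generic) `resH1_injective_of_surjective` — inflation along a surjection is injective on `H¹`
  (the tree's `map_one_injective_of_surjective`, restated for `TorsionControl.resH1`), and
  `oneCocycleClass_zero`;
* §2 `loc_inr_eq_zero_iff` / `inertia_loc_inr_eq_zero_iff` — Greenberg's localisation `loc S ρ (Sum.inr w) 1 y`
  (resp. its restriction to `I_w`) vanishes iff the K2 restriction of the inflated class `resH1 ρ θ y` along
  `localMap K (Sum.inl w)` (resp. `Sum.inr w`) vanishes (`localToUnramified S (Sum.inr w) = θ ∘ localMap K (Sum.inl w)`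
  definitionally); `resH1_localMap_inr_resH1_eq_zero` — at `w ∉ S` the inertia restriction of an inflated
  class is `0` (`θ(I_w) = 1`, `TelescopeK2SelmerInflation.toUnramifiedQuot_localMap_inr`);
* §3 `specOfIndexSet S ρ L₀ : Greenberg2016.Specification S ρ` — the specification MATCHING an index set
  `L₀`: at `v = Sum.inr w`, `w ∈ S`: `L_v = 0` if `Sum.inl w ∈ L₀`, `L_v = H¹_ur` (kernel to `H¹(I_w, 𝐃)`) if
  `Sum.inr w ∈ L₀`, both if both, `⊤` if neither; `⊤` at archimedean `v`;
* §4 THE DICTIONARY: `resH1_mem_selmer` (`y ∈ S_𝓛 ⇒ resH1 ρ θ y ∈ Sel_{L₀}` when `L₀` has no decomposition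
  index off `S`), `exists_mem_selmer_resH1_eq` (every class of `Sel_{L₀}` is `resH1 ρ θ y` with `y ∈ S_𝓛` when
  `L₀ ∋ Sum.inr w` for all `w ∉ S` — surjectivity = `TelescopeK2SelmerInflation.exists_resH1_eq_of_mem_selmer`,
  p745239), `map_resH1_selmer_eq` (`resH1 ρ θ (S_𝓛) = Sel_{L₀}`) and the `Λ`-linear equivalence
  `selmerEquiv : S_𝓛(K, 𝐃) ≃ₗ[Λ] Sel_{L₀}(K, 𝐃|_{Γ_K})`, `selmerEquiv_apply`; `strictSet_hyps` (the K2 index set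
  `strictSet p 𝔮 Σ` qualifies when `𝔮 ∈ S ⊇ Σ ∪ {w ∣ p}`);
* §5 composition with the descent G0 (`TelescopeK2RepDescent.descendUnramified`, p746306): for a
  `Γ_K`-representation `ρ₀` with `N_S ≤ ker ρ₀`, `(descend ρ₀).restrict θ = ρ₀` holds by `rfl`
  (`selmer_restrict_descendUnramified`), whence `selmerEquivOfKer : S_𝓛(K, descend ρ₀) ≃ₗ[Λ] Sel_{L₀}(K, ρ₀)`
  typed on `ρ₀` itself, `selmerEquivOfKer_apply`, `selmerEquivOfKer_injective`.

§5 is items G0 + G1 = sub-leaf W4a of the memo: Greenberg's conclusions about `S_𝓛(K, 𝐃)` (almost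
divisibility, no pseudo-null submodule in the dual) transfer to the K2 line's `selmerBig`/`XBig` along
`selmerEquivOfKer` (with `hS` from `TelescopeK2RepDescent.ramificationSubgroup_le_ker_of_forall_localMap`).

References: [Greenberg2016Selmer] §1 p. 3 (the arena); [NeukirchSchmidtWingberg2008] (1.6.6)–(1.6.7)
(inflation injective in degree 1); [Castella2018Erratum] §2 (Selmer groups as submodules of `H¹(G_{K,S}, M)`).

## References
[cite: Greenberg2016Selmer, §1 p. 3 L19–32] [cite: NeukirchSchmidtWingberg2008, (1.6.6)–(1.6.7)] [cite: Castella2018Erratum, §2]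
-/

set_option linter.dupNamespace false
set_option autoImplicit false

noncomputable section

open Field IsDedekindDomain NumberField Topology CategoryTheory
open Literature.NumberTheory.GaloisRepresentations Literature.NumberTheory.EllipticCurves
open Literature.NumberTheory.IwasawaTheory
open Summit.BirchSwinnertonDyer.Rank1Residual.X11b.TorsionControl
open scoped NumberField ContRepresentation

universe u v

namespace Summit.BirchSwinnertonDyer.BirchSwinnertonDyer.Theorems.TelescopeK2SelmerDictionary

/-! ## §1. Generic: inflation along a surjection is injective on `H¹`; the zero cocycle -/

section Generic

variable {A : Type v} [CommRing A] [TopologicalSpace A]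
variable {Γ : Type u} [Group Γ] [TopologicalSpace Γ] [IsTopologicalGroup Γ]
variable {H : Type u} [Group H] [TopologicalSpace H] [IsTopologicalGroup H]
variable {M : Type u} [AddCommGroup M] [Module A M] [TopologicalSpace M] [DiscreteTopology M]
  [ContinuousSMul A M]

/-- The class of the zero cocycle is zero. [folklore] -/
theorem oneCocycleClass_zero (X : TopRep.{u} A Γ) : oneCocycleClass X 0 = 0 :=
  (oneCocycleClass_eq_zero_iff X 0).2 ⟨0, fun g ↦ by simp⟩

/-- **Inflation along a surjection is injective on `H¹`** for the K2 kernel's restriction map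
`TorsionControl.resH1 ρ θ` (`[φ ∘ θ] = 0 ⇒ [φ] = 0` on `Γ = θ(H)`; the tree's
`map_one_injective_of_surjective`, whose `𝟙 (res θ X)` is `resMod ρ θ` up to definitional unfolding).
[cite: NeukirchSchmidtWingberg2008, (1.6.6)–(1.6.7)] -/
theorem resH1_injective_of_surjective (ρ : ContinuousRep Γ A M) (θ : H →ₜ* Γ)
    (hθ : Function.Surjective θ) : Function.Injective fun x ↦ resH1 ρ θ x := by
  intro x y hxy
  obtain ⟨c, rfl⟩ := oneCocycleClass_surjective _ x
  obtain ⟨d, rfl⟩ := oneCocycleClass_surjective _ y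
  have h0 : resH1 ρ θ (oneCocycleClass _ (c - d)) = 0 := by
    rw [oneCocycleClass_sub, map_sub, sub_eq_zero]
    exact hxy
  rw [map_oneCocycleClass, oneCocycleClass_eq_zero_iff] at h0
  obtain ⟨m, hm⟩ := h0
  rw [← sub_eq_zero, ← oneCocycleClass_sub, oneCocycleClass_eq_zero_iff]
  refine ⟨m, fun g ↦ ?_⟩
  obtain ⟨h, rfl⟩ := hθ g
  have := hm h
  rw [contOneCocycles.pullback_apply] at this
  exact this

end Generic

/-! ## §2. Greenberg's localisation maps versus the K2 restriction maps -/

section Arena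

variable {K : Type u} [Field K] [NumberField K] (S : Set (HeightOneSpectrum (𝓞 K)))
variable {Λ : Type u} [CommRing Λ] [TopologicalSpace Λ]
  {D : Type u} [AddCommGroup D] [Module Λ D] [TopologicalSpace D] [DiscreteTopology D]
  [ContinuousSMul Λ D]
  (ρ : ContinuousRep (GaloisGroupUnramifiedOutside K S) Λ D)

/-- **`loc_v(y) = 0 ⟺ res_{Γ_{K_w}}(infl y) = 0`** at a finite place `v = Sum.inr w`: Greenberg's
`Γ_{K_w} → Γ_K → G_{K,Σ}` (`localToUnramified S (Sum.inr w)`) is `θ ∘ localMap K (Sum.inl w)` and both sides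
unfold to «`y ∘ θ ∘ (Γ_{K_w} → Γ_K)` is a coboundary». [cite: Greenberg2016Selmer, §1 p. 3 L26–28] -/
theorem loc_inr_eq_zero_iff (w : HeightOneSpectrum (𝓞 K)) (y : ρ.H 1) :
    Greenberg2016.loc S ρ (Sum.inr w) 1 y = 0 ↔
      resH1 (ρ.restrict (toUnramifiedQuotCont K S)) (BigGaloisRep.localMap K (Sum.inl w))
        (resH1 ρ (toUnramifiedQuotCont K S) y) = 0 := by
  obtain ⟨c, rfl⟩ := oneCocycleClass_surjective ρ.toTopRep y
  change ContinuousCohomology.map (Greenberg2016.localToUnramified S (Sum.inr w))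
      (resMod ρ (Greenberg2016.localToUnramified S (Sum.inr w))) 1 (oneCocycleClass _ c) = 0 ↔ _
  rw [map_oneCocycleClass, map_oneCocycleClass, map_oneCocycleClass, oneCocycleClass_eq_zero_iff,
    oneCocycleClass_eq_zero_iff]
  exact Iff.rfl

/-- **`res_{I_w}(loc_v(y)) = 0 ⟺ res_{I_w}(infl y) = 0`** (the unramified condition at `v = Sum.inr w` in the
two models): both sides unfold to «`y ∘ θ ∘ (I_w → Γ_K)` is a coboundary».
[cite: Greenberg2016Selmer, §1 p. 3 L26–28] -/
theorem inertia_loc_inr_eq_zero_iff (w : HeightOneSpectrum (𝓞 K)) (y : ρ.H 1) :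
    (Greenberg2016.localRep S ρ (Sum.inr w)).Hpullback (BigGaloisRep.inertiaIncl K w) 1
        (Greenberg2016.loc S ρ (Sum.inr w) 1 y) = 0 ↔
      resH1 (ρ.restrict (toUnramifiedQuotCont K S)) (BigGaloisRep.localMap K (Sum.inr w))
        (resH1 ρ (toUnramifiedQuotCont K S) y) = 0 := by
  obtain ⟨c, rfl⟩ := oneCocycleClass_surjective ρ.toTopRep y
  change ContinuousCohomology.map
      (BigGaloisRep.inertiaIncl K w :
        ↥(absInertia (w.adicCompletion K)) →ₜ* absoluteGaloisGroup (Place.Completion (Sum.inr w : Place K)))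
      (resMod (ρ.restrict (Greenberg2016.localToUnramified S (Sum.inr w))) (BigGaloisRep.inertiaIncl K w)) 1
      (ContinuousCohomology.map (Greenberg2016.localToUnramified S (Sum.inr w))
        (resMod ρ (Greenberg2016.localToUnramified S (Sum.inr w))) 1 (oneCocycleClass _ c)) = 0 ↔ _
  rw [map_oneCocycleClass, map_oneCocycleClass, map_oneCocycleClass]
  -- the outer pull-back along `I_w ↪ Γ_{K_w}`: `Place.Completion (Sum.inr w)` is `w.adicCompletion K` only up to
  -- definitional unfolding, which `rw`'s reducible matching does not perform; `erw` does.
  erw [map_oneCocycleClass]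
  rw [oneCocycleClass_eq_zero_iff, oneCocycleClass_eq_zero_iff]
  exact Iff.rfl

/-- **At `w ∉ S` an inflated class is unramified**: `res_{I_w}(infl_θ y) = 0`, because `θ(I_w) = 1`
(`I_w ≤ N_S`, `TelescopeK2SelmerInflation.toUnramifiedQuot_localMap_inr`) and a cocycle vanishes at `1`.
[cite: NeukirchSchmidtWingberg2008, VIII §3] -/
theorem resH1_localMap_inr_resH1_eq_zero {w : HeightOneSpectrum (𝓞 K)} (hw : w ∉ S) (y : ρ.H 1) :
    resH1 (ρ.restrict (toUnramifiedQuotCont K S)) (BigGaloisRep.localMap K (Sum.inr w))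
      (resH1 ρ (toUnramifiedQuotCont K S) y) = 0 := by
  obtain ⟨c, rfl⟩ := oneCocycleClass_surjective ρ.toTopRep y
  rw [map_oneCocycleClass, map_oneCocycleClass]
  have h0 : contOneCocycles.pullback (BigGaloisRep.localMap K (Sum.inr w))
      (resMod (ρ.restrict (toUnramifiedQuotCont K S)) (BigGaloisRep.localMap K (Sum.inr w)))
      (contOneCocycles.pullback (toUnramifiedQuotCont K S) (resMod ρ (toUnramifiedQuotCont K S)) c) = 0 := by
    apply Subtype.ext
    ext i
    change c.1 (toUnramifiedQuotCont K S (BigGaloisRep.localMap K (Sum.inr w) i)) = 0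
    rw [toUnramifiedQuotCont_apply, TelescopeK2SelmerInflation.toUnramifiedQuot_localMap_inr K S hw i]
    exact contOneCocycles.apply_one c
  rw [h0]
  exact oneCocycleClass_zero _

/-! ## §3. The specification matching an index set -/

/-- **The Greenberg specification `𝓛(L₀)` matching a K2 index set `L₀ ⊆ LocalIndex K`**: at a finite
`v = Sum.inr w` the local condition is `0` if the decomposition index `Sum.inl w` is in `L₀`, the unramified
classes `ker (H¹(K_w, 𝐃) → H¹(I_w, 𝐃))` (restriction along `BigGaloisRep.inertiaIncl K w`) if the inertia index `Sum.inr w` is in `L₀` (their intersection if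
both are, everything if neither is); no condition at the archimedean places. Only its values at `v ∈ Σ`
matter (`Specification.selmer`). [cite: Greenberg2016Selmer, §1 p. 3 L19–25] [cite: Castella2018Erratum, §2] -/
def specOfIndexSet (L₀ : Set (BigGaloisRep.LocalIndex K)) : Greenberg2016.Specification S ρ
  | Sum.inl _ => ⊤
  | Sum.inr w =>
      (⨅ (_ : (Sum.inl w : BigGaloisRep.LocalIndex K) ∈ L₀),
          (⊥ : Submodule Λ ((Greenberg2016.localRep S ρ (Sum.inr w)).H 1))) ⊓
        ⨅ (_ : (Sum.inr w : BigGaloisRep.LocalIndex K) ∈ L₀),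
          LinearMap.ker ((Greenberg2016.localRep S ρ (Sum.inr w)).Hpullback (BigGaloisRep.inertiaIncl K w) 1)

/-- Unfolding at an archimedean place. [folklore] -/
@[simp] theorem specOfIndexSet_inl (L₀ : Set (BigGaloisRep.LocalIndex K)) (v : InfinitePlace K) :
    specOfIndexSet S ρ L₀ (Sum.inl v) = ⊤ := rfl

/-- Membership at a finite place. [folklore] -/
theorem mem_specOfIndexSet_inr_iff (L₀ : Set (BigGaloisRep.LocalIndex K)) (w : HeightOneSpectrum (𝓞 K))
    (z : (Greenberg2016.localRep S ρ (Sum.inr w)).H 1) :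
    z ∈ specOfIndexSet S ρ L₀ (Sum.inr w) ↔
      ((Sum.inl w : BigGaloisRep.LocalIndex K) ∈ L₀ → z = 0) ∧
        ((Sum.inr w : BigGaloisRep.LocalIndex K) ∈ L₀ →
          (Greenberg2016.localRep S ρ (Sum.inr w)).Hpullback (BigGaloisRep.inertiaIncl K w) 1 z = 0) := by
  change z ∈ (⨅ (_ : (Sum.inl w : BigGaloisRep.LocalIndex K) ∈ L₀), (⊥ : Submodule Λ _)) ⊓
        ⨅ (_ : (Sum.inr w : BigGaloisRep.LocalIndex K) ∈ L₀),
          LinearMap.ker ((Greenberg2016.localRep S ρ (Sum.inr w)).Hpullback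
            (BigGaloisRep.inertiaIncl K w) 1) ↔ _
  simp only [Submodule.mem_inf, Submodule.mem_iInf, Submodule.mem_bot, LinearMap.mem_ker]

/-! ## §4. The dictionary -/

/-- **`S_{𝓛(L₀)} ↪ Sel_{L₀}` under inflation**: if `L₀` imposes no DECOMPOSITION condition off `S`, then for
every `y ∈ S_{𝓛(L₀)}(K, 𝐃)` the inflated class `resH1 ρ θ y` lies in the K2 Selmer group
`TorsionControl.selmer (localMap K) L₀ (ρ.restrict θ)` (conditions at `w ∈ S` match by §2–§3; the inertia
conditions at `w ∉ S` hold for free, `resH1_localMap_inr_resH1_eq_zero`).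
[cite: Greenberg2016Selmer, §1 p. 3 L26–32] [cite: Castella2018Erratum, §2] -/
theorem resH1_mem_selmer (L₀ : Set (BigGaloisRep.LocalIndex K))
    (hoff : ∀ w : HeightOneSpectrum (𝓞 K), w ∉ S → (Sum.inl w : BigGaloisRep.LocalIndex K) ∉ L₀)
    {y : ρ.H 1} (hy : y ∈ (specOfIndexSet S ρ L₀).selmer) :
    resH1 ρ (toUnramifiedQuotCont K S) y ∈
      selmer (BigGaloisRep.localMap K) L₀ (ρ.restrict (toUnramifiedQuotCont K S)) := by
  rw [Greenberg2016.Specification.mem_selmer_iff] at hy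
  rw [mem_selmer_iff]
  rintro (w | w) hi
  · -- decomposition index: then `w ∈ S`
    have hwS : w ∈ S := by
      by_contra h
      exact hoff w h hi
    have hv := (mem_specOfIndexSet_inr_iff S ρ L₀ w _).1 (hy ⟨Sum.inr w, hwS⟩)
    exact (loc_inr_eq_zero_iff S ρ w y).1 (hv.1 hi)
  · by_cases hwS : w ∈ S
    · have hv := (mem_specOfIndexSet_inr_iff S ρ L₀ w _).1 (hy ⟨Sum.inr w, hwS⟩)
      exact (inertia_loc_inr_eq_zero_iff S ρ w y).1 (hv.2 hi)
    · exact resH1_localMap_inr_resH1_eq_zero S ρ hwS y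

/-- **`Sel_{L₀} ⊆ infl(S_{𝓛(L₀)})`**: if `L₀` contains the inertia index of every `w ∉ S`, every class of the K2
Selmer group is inflated from a class of `S_{𝓛(L₀)}(K, 𝐃)` (existence of the inflating class:
`TelescopeK2SelmerInflation.exists_resH1_eq_of_mem_selmer`; its membership in `S_{𝓛(L₀)}`: §2–§3).
[cite: Greenberg2016Selmer, §1 p. 3 L26–32] [cite: Castella2018Erratum, §2] -/
theorem exists_mem_selmer_resH1_eq (L₀ : Set (BigGaloisRep.LocalIndex K))
    (hL : ∀ w : HeightOneSpectrum (𝓞 K), w ∉ S → (Sum.inr w : BigGaloisRep.LocalIndex K) ∈ L₀)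
    {x : continuousCohomology 1 (ρ.restrict (toUnramifiedQuotCont K S)).toTopRep}
    (hx : x ∈ selmer (BigGaloisRep.localMap K) L₀ (ρ.restrict (toUnramifiedQuotCont K S))) :
    ∃ y : ρ.H 1, y ∈ (specOfIndexSet S ρ L₀).selmer ∧ resH1 ρ (toUnramifiedQuotCont K S) y = x := by
  obtain ⟨y, rfl⟩ := TelescopeK2SelmerInflation.exists_resH1_eq_of_mem_selmer K S ρ L₀ hL hx
  refine ⟨y, ?_, rfl⟩
  rw [Greenberg2016.Specification.mem_selmer_iff]
  rw [mem_selmer_iff] at hx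
  rintro ⟨v | w, hv⟩
  · exact Submodule.mem_top
  · have hwS : w ∈ S := (Greenberg2016.inSigma_inr_iff S w).1 hv
    refine (mem_specOfIndexSet_inr_iff S ρ L₀ w _).2 ⟨fun hi ↦ ?_, fun hi ↦ ?_⟩
    · exact (loc_inr_eq_zero_iff S ρ w y).2 (hx _ hi)
    · exact (inertia_loc_inr_eq_zero_iff S ρ w y).2 (hx _ hi)

/-- **THE DICTIONARY `infl_θ(S_{𝓛(L₀)}(K, 𝐃)) = Sel_{L₀}(K, 𝐃|_{Γ_K})`** when `L₀` contains the inertia index and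
not the decomposition index of every finite `w ∉ S` (e.g. `L₀ = strictSet p 𝔮 Σ` with `S ⊇ Σ ∪ {w ∣ p}`).
[cite: Greenberg2016Selmer, §1 p. 3 L26–32] [cite: Castella2018Erratum, §2] -/
theorem map_resH1_selmer_eq (L₀ : Set (BigGaloisRep.LocalIndex K))
    (hL : ∀ w : HeightOneSpectrum (𝓞 K), w ∉ S → (Sum.inr w : BigGaloisRep.LocalIndex K) ∈ L₀)
    (hoff : ∀ w : HeightOneSpectrum (𝓞 K), w ∉ S → (Sum.inl w : BigGaloisRep.LocalIndex K) ∉ L₀) :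
    Submodule.map (resH1 ρ (toUnramifiedQuotCont K S)).hom.toLinearMap (specOfIndexSet S ρ L₀).selmer =
      selmer (BigGaloisRep.localMap K) L₀ (ρ.restrict (toUnramifiedQuotCont K S)) := by
  ext x
  rw [Submodule.mem_map]
  constructor
  · rintro ⟨y, hy, rfl⟩
    exact resH1_mem_selmer S ρ L₀ hoff hy
  · intro hx
    obtain ⟨y, hy, rfl⟩ := exists_mem_selmer_resH1_eq S ρ L₀ hL hx
    exact ⟨y, hy, rfl⟩

omit [NumberField K] in
/-- Inflation is injective on `H¹(K_Σ/K, 𝐃)` (`Γ_K ↠ G_{K,Σ}` is onto). [cite: NeukirchSchmidtWingberg2008, (1.6.6)–(1.6.7)] -/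
theorem resH1_toUnramifiedQuotCont_injective :
    Function.Injective fun y : ρ.H 1 ↦ resH1 ρ (toUnramifiedQuotCont K S) y :=
  resH1_injective_of_surjective ρ (toUnramifiedQuotCont K S) (toUnramifiedQuot_surjective K S)

/-- **`S_{𝓛(L₀)}(K, 𝐃) ≃ₗ[Λ] Sel_{L₀}(K, 𝐃|_{Γ_K})`**, the `Λ`-linear equivalence given by inflation (injective:
`resH1_toUnramifiedQuotCont_injective`; image: `map_resH1_selmer_eq`). Along it every structural conclusion
about `S_𝓛(K, 𝐃)` ([Gr16] Prop. 4.1.1: almost divisibility; no pseudo-null submodule of the dual) is a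
conclusion about the K2 line's Selmer group. [cite: Greenberg2016Selmer, §1 p. 3 L26–32] -/
def selmerEquiv (L₀ : Set (BigGaloisRep.LocalIndex K))
    (hL : ∀ w : HeightOneSpectrum (𝓞 K), w ∉ S → (Sum.inr w : BigGaloisRep.LocalIndex K) ∈ L₀)
    (hoff : ∀ w : HeightOneSpectrum (𝓞 K), w ∉ S → (Sum.inl w : BigGaloisRep.LocalIndex K) ∉ L₀) :
    (specOfIndexSet S ρ L₀).selmer ≃ₗ[Λ]
      selmer (BigGaloisRep.localMap K) L₀ (ρ.restrict (toUnramifiedQuotCont K S)) :=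
  (Submodule.equivMapOfInjective (resH1 ρ (toUnramifiedQuotCont K S)).hom.toLinearMap
      (resH1_toUnramifiedQuotCont_injective S ρ) _).trans
    (LinearEquiv.ofEq _ _ (map_resH1_selmer_eq S ρ L₀ hL hoff))

/-- `selmerEquiv` is inflation on underlying classes. [folklore] -/
@[simp] theorem selmerEquiv_apply (L₀ : Set (BigGaloisRep.LocalIndex K))
    (hL : ∀ w : HeightOneSpectrum (𝓞 K), w ∉ S → (Sum.inr w : BigGaloisRep.LocalIndex K) ∈ L₀)
    (hoff : ∀ w : HeightOneSpectrum (𝓞 K), w ∉ S → (Sum.inl w : BigGaloisRep.LocalIndex K) ∉ L₀)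
    (y : (specOfIndexSet S ρ L₀).selmer) :
    (selmerEquiv S ρ L₀ hL hoff y : continuousCohomology 1 (ρ.restrict (toUnramifiedQuotCont K S)).toTopRep) =
      resH1 ρ (toUnramifiedQuotCont K S) (y : ρ.H 1) := rfl

omit [NumberField K] in
/-- **The `strictSet` instance** (the K2 line's `Sel^Σ_𝔮`): for `S ⊇ Σ ∪ {w ∣ p}` the erratum's index set
`strictSet p 𝔮 Σ` contains `Sum.inr w` and not `Sum.inl w` for every `w ∉ S`
(`BigGaloisRep.inr_mem_strictSet_iff`, `inl_mem_strictSet_iff`), so `selmerEquiv` applies.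
[cite: Castella2018Erratum, §2] [cite: Castella2018, Def. 2.2 (p. 4)] -/
theorem strictSet_hyps (p : ℕ) (𝔮 : HeightOneSpectrum (𝓞 K)) (Sig : Set (HeightOneSpectrum (𝓞 K)))
    (h𝔮 : 𝔮 ∈ S) (hS : ∀ w, w ∉ S → w ∉ Sig ∧ ((p : ℕ) : 𝓞 K) ∉ w.asIdeal) :
    (∀ w : HeightOneSpectrum (𝓞 K), w ∉ S →
        (Sum.inr w : BigGaloisRep.LocalIndex K) ∈ BigGaloisRep.strictSet p 𝔮 Sig) ∧
      ∀ w : HeightOneSpectrum (𝓞 K), w ∉ S →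
        (Sum.inl w : BigGaloisRep.LocalIndex K) ∉ BigGaloisRep.strictSet p 𝔮 Sig := by
  refine ⟨fun w hw ↦ (BigGaloisRep.inr_mem_strictSet_iff p 𝔮 w Sig).mpr (hS w hw), fun w hw h ↦ ?_⟩
  rw [BigGaloisRep.inl_mem_strictSet_iff] at h
  exact hw (by rw [h]; exact h𝔮)

/-! ## §5. For a `Γ_K`-representation unramified outside `S` (composition with the descent G0)

For `ρ₀ : ContinuousRep Γ_K Λ D` with `ramificationSubgroup K S ≤ ker ρ₀` the descended representation
`TelescopeK2RepDescent.descendUnramified S ρ₀ hS` of `G_{K,S}` restricts back to `ρ₀` DEFINITIONALLY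
(`TelescopeK2RepDescent.restrict_descendUnramified`), so `selmerEquiv` lands literally in the K2 line's
`TorsionControl.selmer (localMap K) L₀ ρ₀` — no transport along an equality of representations is needed. -/

/-- The K2 Selmer group of `ρ₀` IS the K2 Selmer group of `(descend ρ₀)|_θ` (by `rfl`). [folklore] -/
theorem selmer_restrict_descendUnramified (ρ₀ : ContinuousRep (absoluteGaloisGroup K) Λ D)
    (hS : ramificationSubgroup K S ≤ ρ₀.ker) (L₀ : Set (BigGaloisRep.LocalIndex K)) :
    selmer (BigGaloisRep.localMap K) L₀
        ((TelescopeK2RepDescent.descendUnramified S ρ₀ hS).restrict (toUnramifiedQuotCont K S)) =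
      selmer (BigGaloisRep.localMap K) L₀ ρ₀ := rfl

/-- **THE DICTIONARY FOR A `Γ_K`-REPRESENTATION UNRAMIFIED OUTSIDE `S`**:
`S_{𝓛(L₀)}(K, descend ρ₀) ≃ₗ[Λ] Sel_{L₀}(K, ρ₀)` (Greenberg's Selmer group of the descended `G_{K,S}`-representation
versus the K2 line's `TorsionControl.selmer` of `ρ₀` itself), for `L₀` unramified-type off `S`.
Typical use: `ρ₀ = 𝐓 ⊗ Λ^*` a big Galois representation, `hS` from
`TelescopeK2RepDescent.ramificationSubgroup_le_ker_of_forall_localMap`, `L₀ = strictSet p 𝔮 Σ` (`strictSet_hyps`).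
[cite: Greenberg2016Selmer, §1 p. 3 L22–34] [cite: Castella2018Erratum, §2] -/
def selmerEquivOfKer (ρ₀ : ContinuousRep (absoluteGaloisGroup K) Λ D) (hS : ramificationSubgroup K S ≤ ρ₀.ker)
    (L₀ : Set (BigGaloisRep.LocalIndex K))
    (hL : ∀ w : HeightOneSpectrum (𝓞 K), w ∉ S → (Sum.inr w : BigGaloisRep.LocalIndex K) ∈ L₀)
    (hoff : ∀ w : HeightOneSpectrum (𝓞 K), w ∉ S → (Sum.inl w : BigGaloisRep.LocalIndex K) ∉ L₀) :
    (specOfIndexSet S (TelescopeK2RepDescent.descendUnramified S ρ₀ hS) L₀).selmer ≃ₗ[Λ]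
      selmer (BigGaloisRep.localMap K) L₀ ρ₀ :=
  selmerEquiv S (TelescopeK2RepDescent.descendUnramified S ρ₀ hS) L₀ hL hoff

/-- `selmerEquivOfKer` is inflation `H¹(G_{K,S}, D) → H¹(Γ_K, D)` on underlying classes. [folklore] -/
@[simp] theorem selmerEquivOfKer_apply (ρ₀ : ContinuousRep (absoluteGaloisGroup K) Λ D)
    (hS : ramificationSubgroup K S ≤ ρ₀.ker) (L₀ : Set (BigGaloisRep.LocalIndex K))
    (hL : ∀ w : HeightOneSpectrum (𝓞 K), w ∉ S → (Sum.inr w : BigGaloisRep.LocalIndex K) ∈ L₀)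
    (hoff : ∀ w : HeightOneSpectrum (𝓞 K), w ∉ S → (Sum.inl w : BigGaloisRep.LocalIndex K) ∉ L₀)
    (y : (specOfIndexSet S (TelescopeK2RepDescent.descendUnramified S ρ₀ hS) L₀).selmer) :
    (selmerEquivOfKer S ρ₀ hS L₀ hL hoff y : continuousCohomology 1 ρ₀.toTopRep) =
      resH1 (TelescopeK2RepDescent.descendUnramified S ρ₀ hS) (toUnramifiedQuotCont K S)
        (y : (TelescopeK2RepDescent.descendUnramified S ρ₀ hS).H 1) := rfl

/-- Injectivity restated on `ρ₀`: two Greenberg-Selmer classes with the same image in `H¹(Γ_K, D)` are equal. [folklore] -/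
theorem selmerEquivOfKer_injective (ρ₀ : ContinuousRep (absoluteGaloisGroup K) Λ D)
    (hS : ramificationSubgroup K S ≤ ρ₀.ker) (L₀ : Set (BigGaloisRep.LocalIndex K))
    (hL : ∀ w : HeightOneSpectrum (𝓞 K), w ∉ S → (Sum.inr w : BigGaloisRep.LocalIndex K) ∈ L₀)
    (hoff : ∀ w : HeightOneSpectrum (𝓞 K), w ∉ S → (Sum.inl w : BigGaloisRep.LocalIndex K) ∉ L₀) :
    Function.Injective (selmerEquivOfKer S ρ₀ hS L₀ hL hoff) :=
  (selmerEquivOfKer S ρ₀ hS L₀ hL hoff).injective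

end Arena

end Summit.BirchSwinnertonDyer.BirchSwinnertonDyer.Theorems.TelescopeK2SelmerDictionary

end
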